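import Literature.AlgebraicGeometry.Frobenioids.Cor412Closed
import Literature.AlgebraicGeometry.Frobenioids.Thm34ivvOverFSMFF2024
import HarnessLib

/-!
# Frobenioids I, Corollary 4.12 AS TYPED over bases of FSMFF-type in the author's REVISED (2024) sense —
# unconditional closer (no named fact)

Mochizuki, *The geometry of Frobenioids I: the general theory*, Kyushu J. Math. **62** (2008)
293–400, kurims text, Cor. 4.12 p. 94 l. 44 – p. 95 l. 17, proof p. 95 ll. 18–40
[cite: MochizukiFrdI2008, Cor. 4.12 p.95]; hypothesis (d) "FSMFF-type" of "standard type" (Def. 3.1 (i) p. 56)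
read as revised in the author's *Comments* (January 2024), item (28) [cite: MochizukiFrdIComments2024, (28) p.3].

PROOF-ONLY file (seat abc-iut-w4-d088; downstream of GAP-LEDGER row G-L1d8-1, per abc-iut-L1-lead R100 (1)).
Abc-iut-w5-d222's `Cor412Closed.lean` (cell sub-DAG W9) closes the typed `PreFrobenioidData.Cor412` for every pair
of Frobenioids over bases of FSM-type, consuming Thm. 3.4 (ii)/(iii) for `Ψ^istr` and Thm. 3.4 (iv) at the two
birationalizations `(C_i^istr)^birat → F_{0_{D_i}}` as the FSM-type tree theorems. This file is its twin over the
WIDER class of bases of FSMFF-type in the revised sense (⊋ FSM-type; the statement of Thm. 3.4 as the author now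
asserts it): the three inputs are replaced by abc-iut-L1-t11's `FrdI.isCoAngularPreStep_map_of_quasiIsotropic_of_
isOfFSMFFType2024` / `FrdI.thm34iii_ofFunctor_of_isOfFSMFFType2024` and by `FrdI.thm34iv_ofFunctor_of_isOfFSMFFType2024`
(`Thm34ivvOverFSMFF2024.lean`); everything else (Cor. 4.10's `Ψ^birat` `Birat.exists_equivalence_over`, the
`F_{0_D}`-square `exists_toBaseDeg_equivalence_of_birat_pieces`, `cor412_of_istr`) is w5-d222's / abc-iut-L1-t10's /
abc-iut-L6-t20's, consumed BY NAME. Result: `FrdI.cor412_of_isOfFSMFFType2024` — the typed Cor. 4.12 for every pair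
of Frobenioids over FSMFF-type (revised) bases and every `Ψ`, with NO named fact, given only (at `C_i^istr`) the
birationalizations' Frobenioid structures `hB_i` (Prop. 4.4 (ii)) of standard type `hstd_i` (Prop. 4.8 (iii)).
(The Cor. 4.10 twin `cor410_biratData_of_isOfFSMFFType2024` is abc-iut-L1-t10's, `BirationalizationCor410FSMFF2024.lean`.)
No statement of the paper is restated or strengthened; no new definition; nothing bears on [IUTchIII] Cor. 3.12.
-/

namespace Literature.AlgebraicGeometry.Frobenioids

open CategoryTheory Opposite

universe w v v' u u'

namespace FrdI

open PreFrobenioid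

section Isotropic

variable {D₁ : Type u} [Category.{v} D₁] {Φ₁ : D₁ᵒᵖ ⥤ CommMonCat.{w}}
  {C₁ : Type u'} [Category.{v'} C₁] {F₁ : C₁ ⥤ ElemFrobenioid Φ₁}
  {D₂ : Type u} [Category.{v} D₂] {Φ₂ : D₂ᵒᵖ ⥤ CommMonCat.{w}}
  {C₂ : Type u'} [Category.{v'} C₂] {F₂ : C₂ ⥤ ElemFrobenioid Φ₂}

/-- **The `F_{0_D}`-square of Cor. 4.12 over FSMFF-type (revised) bases, unconditionally in Thm. 3.4 (iv)**, for
Frobenioids of isotropic type (print p. 95 ll. 30–39): as abc-iut-w5-d222's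
`exists_toBaseDeg_equivalence_of_isOfFSMType`, with the units of `Ψ^birat` and of its quasi-inverse taken from
`FrdI.thm34iv_ofFunctor_of_isOfFSMFFType2024` for the Frobenioids `C_i^birat → F_{0_{D_i}}` (`hB_i`, Prop. 4.4 (ii))
over the FSMFF-type (revised) bases `D_i`. [cite: MochizukiFrdI2008, Cor. 4.12 p.95] -/
theorem exists_toBaseDeg_equivalence_of_isOfFSMFFType2024
    (hF₁ : IsFrobenioid F₁) (hsq₁ : HasBiratSquares F₁) (hF₂ : IsFrobenioid F₂) (hsq₂ : HasBiratSquares F₂)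
    (Ψ : C₁ ≌ C₂)
    (hB₁ : IsFrobenioid (Birat.toElemZero hF₁ hsq₁)) (hB₂ : IsFrobenioid (Birat.toElemZero hF₂ hsq₂))
    (hC₁ : (PreFrobenioidData.ofFunctor Φ₁ F₁).IsOfIsotropicType)
    (hC₂ : (PreFrobenioidData.ofFunctor Φ₂ F₂).IsOfIsotropicType)
    (hD₁ : IsOfFSMFFType2024 D₁) (hD₂ : IsOfFSMFFType2024 D₂)
    (hstd₁ : (biratOps hF₁ hsq₁).IsOfStandardType) (hstd₂ : (biratOps hF₂ hsq₂).IsOfStandardType)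
    (hfs₁ : IsFrobeniusSlim D₁) (hfs₂ : IsFrobeniusSlim D₂)
    (hΨ : ∀ ⦃A B : C₁⦄ (f : A ⟶ B), IsCoAngularPreStep F₁ f → IsCoAngularPreStep F₂ (Ψ.functor.map f))
    (hΨ' : ∀ ⦃A B : C₂⦄ (f : A ⟶ B), IsCoAngularPreStep F₂ f → IsCoAngularPreStep F₁ (Ψ.inverse.map f))
    (hbi : PreFrobenioidData.PreservesMor Ψ.functor (PreFrobenioidData.ofFunctor Φ₁ F₁).IsBaseIso
      (PreFrobenioidData.ofFunctor Φ₂ F₂).IsBaseIso)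
    (hbi' : PreFrobenioidData.PreservesMor Ψ.inverse (PreFrobenioidData.ofFunctor Φ₂ F₂).IsBaseIso
      (PreFrobenioidData.ofFunctor Φ₁ F₁).IsBaseIso) :
    ∃ Ψ0 : D₁ × SingleObj ℕ+ ⥤ D₂ × SingleObj ℕ+, Ψ0.IsEquivalence ∧
      OneCommutes Ψ.functor (PreFrobenioidData.ofFunctor Φ₂ F₂).toBaseDeg
        (PreFrobenioidData.ofFunctor Φ₁ F₁).toBaseDeg Ψ0 := by
  obtain ⟨Eb, ⟨sq⟩, hHypB, hHypB'⟩ :=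
    Birat.exists_equivalence_over hF₁ hsq₁ hF₂ hsq₂ Ψ hΨ hΨ' hbi hbi'
  -- Thm. 3.4 (iv) (tree theorem over FSMFF-type (revised) bases) for `Ψ^birat` and its quasi-inverse: `O^×(−)`
  obtain ⟨-, hu, -⟩ :=
    FrdI.thm34iv_ofFunctor_of_isOfFSMFFType2024 hB₁ hB₂ hD₁ hD₂ Eb hstd₁ hstd₂ hHypB hfs₁ hfs₂
  obtain ⟨-, hu', -⟩ :=
    FrdI.thm34iv_ofFunctor_of_isOfFSMFFType2024 hB₂ hB₁ hD₂ hD₁ Eb.symm hstd₂ hstd₁ hHypB' hfs₂ hfs₁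
  exact exists_toBaseDeg_equivalence_of_birat_pieces hF₁ hsq₁ hF₂ hsq₂ Ψ hB₁ hB₂ hstd₁.fsmff hstd₂.fsmff
    (PreFrobenioidData.isOfIsotropicType_ofFunctor_toElemZero hF₁ hsq₁ hC₁)
    (PreFrobenioidData.isOfIsotropicType_ofFunctor_toElemZero hF₂ hsq₂ hC₂) Eb sq hu hu'

end Isotropic

section General

variable {D₁ : Type u} [Category.{v} D₁] {Φ₁ : D₁ᵒᵖ ⥤ CommMonCat.{w}}
  {C₁ : Type u'} [Category.{v'} C₁] {F₁ : C₁ ⥤ ElemFrobenioid Φ₁}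
  {D₂ : Type u} [Category.{v} D₂] {Φ₂ : D₂ᵒᵖ ⥤ CommMonCat.{w}}
  {C₂ : Type u'} [Category.{v'} C₂] {F₂ : C₂ ⥤ ElemFrobenioid Φ₂}

/-- **[FrdI] Corollary 4.12 AS TYPED, for every pair of Frobenioids over bases of FSMFF-type in the revised
(2024) sense — with NO named fact** (print p. 94 l. 44 – p. 95 l. 40): for Frobenioids `C_i → F_{Φ_i}` over such
bases and an equivalence `Ψ : C₁ ⥲ C₂`, GIVEN only — at the Frobenioids `C_i^istr` — THE birationalizations'
Frobenioid structures `(C_i^istr)^birat → F_{0_{D_i}}` (`hB_i`, Prop. 4.4 (ii)) of standard type (`hstd_i`,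
Prop. 4.8 (iii)), the typed Cor. 4.12 (`PreFrobenioidData.Cor412`) holds for `Ψ` under its own printed antecedents.
Route = abc-iut-w5-d222's `cor412_of_isOfFSMType` with the three FSM-type inputs replaced by their FSMFF-type
(revised) versions: Thm. 3.4 (ii) co-angular pre-steps and Thm. 3.4 (iii) base-isomorphisms for `Ψ^istr`
(abc-iut-L1-t11), Thm. 3.4 (iv) at the birationalizations (`FrdI.thm34iv_ofFunctor_of_isOfFSMFFType2024`).
[cite: MochizukiFrdI2008, Cor. 4.12 p.95] [cite: MochizukiFrdIComments2024, (28) p.3] -/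
theorem cor412_of_isOfFSMFFType2024 (hF₁ : IsFrobenioid F₁) (hF₂ : IsFrobenioid F₂)
    (hD₁ : IsOfFSMFFType2024 D₁) (hD₂ : IsOfFSMFFType2024 D₂)
    (hsq₁ : HasBiratSquares (istrFunctor F₁)) (hsq₂ : HasBiratSquares (istrFunctor F₂))
    (hB₁ : IsFrobenioid (Birat.toElemZero (isFrobenioid_istr hF₁) hsq₁))
    (hB₂ : IsFrobenioid (Birat.toElemZero (isFrobenioid_istr hF₂) hsq₂))
    (hstd₁ : (biratOps (isFrobenioid_istr hF₁) hsq₁).IsOfStandardType)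
    (hstd₂ : (biratOps (isFrobenioid_istr hF₂) hsq₂).IsOfStandardType) (Ψ : C₁ ≌ C₂)
    (R₁ : (PreFrobenioidData.ofFunctor Φ₁ F₁).RSParams) (R₂ : (PreFrobenioidData.ofFunctor Φ₂ F₂).RSParams) :
    (PreFrobenioidData.ofFunctor Φ₁ F₁).Cor412 (PreFrobenioidData.ofFunctor Φ₂ F₂) Ψ R₁ R₂ := by
  intro hfs₁ hfs₂ hR₁ hR₂ hB
  have hs₁ := hR₁.standard
  have hs₂ := hR₂.standard
  -- Thm. 3.4 (i): the restriction `Ψ^istr` and its square with the isotropifications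
  haveI : (isotropicObjects F₂).IsClosedUnderIsomorphisms :=
    ⟨fun e hX => IsIsotropic.of_iso hF₂.isPreFrobenioid e.symm hX⟩
  have hinv := FrdI.isotropicObjects_inverseImage hF₁ hs₁.quasiIsotropic hs₂.quasiIsotropic Ψ
  let Ψi : Istr F₁ ≌ Istr F₂ := Ψ.congrFullSubcategory hinv
  obtain ⟨core⟩ := nonempty_isotropification_comp_iso hF₁ hF₂ hs₁.quasiIsotropic hs₂.quasiIsotropic Ψ
  -- Rem. 4.5.1: `C_i^istr` of standard type; hypothesis (b) for `Ψ^istr` and for its inverse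
  have hs₁' := isOfStandardType_istr hF₁ hs₁
  have hs₂' := isOfStandardType_istr hF₂ hs₂
  have hBi : (PreFrobenioidData.ofFunctor Φ₁ (istrFunctor F₁)).HypB
      (PreFrobenioidData.ofFunctor Φ₂ (istrFunctor F₂)) Ψi := hypB_istr hF₁ hF₂ Ψ hinv hB
  have hBi' : (PreFrobenioidData.ofFunctor Φ₂ (istrFunctor F₂)).HypB
      (PreFrobenioidData.ofFunctor Φ₁ (istrFunctor F₁)) Ψi.symm :=
    fun hg₂ hg₁ => ⟨(hBi hg₁ hg₂).2, (hBi hg₁ hg₂).1⟩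
  -- Thm. 3.4 (ii): `Ψ^istr`, `(Ψ^istr)⁻¹` preserve co-angular pre-steps (bases of FSMFF-type, revised)
  have hΨ : ∀ ⦃A B : Istr F₁⦄ (f : A ⟶ B),
      IsCoAngularPreStep (istrFunctor F₁) f → IsCoAngularPreStep (istrFunctor F₂) (Ψi.functor.map f) :=
    fun A B f hf => FrdI.isCoAngularPreStep_map_of_quasiIsotropic_of_isOfFSMFFType2024 (isFrobenioid_istr hF₁)
      (isFrobenioid_istr hF₂) hs₁'.quasiIsotropic hs₂'.quasiIsotropic hD₁ hD₂ Ψi hf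
  have hΨ' : ∀ ⦃A B : Istr F₂⦄ (f : A ⟶ B),
      IsCoAngularPreStep (istrFunctor F₂) f → IsCoAngularPreStep (istrFunctor F₁) (Ψi.inverse.map f) :=
    fun A B f hf => FrdI.isCoAngularPreStep_map_of_quasiIsotropic_of_isOfFSMFFType2024 (isFrobenioid_istr hF₂)
      (isFrobenioid_istr hF₁) hs₂'.quasiIsotropic hs₁'.quasiIsotropic hD₂ hD₁ Ψi.symm hf
  -- Thm. 3.4 (iii): `Ψ^istr`, `(Ψ^istr)⁻¹` preserve base-isomorphisms (bases of FSMFF-type, revised)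
  obtain ⟨⟨-, -, hbi, -, -, -, -⟩, -⟩ := FrdI.thm34iii_ofFunctor_of_isOfFSMFFType2024 (isFrobenioid_istr hF₁)
    (isFrobenioid_istr hF₂) hD₁ hD₂ Ψi hs₁' hs₂' hBi
  obtain ⟨⟨-, -, hbi', -, -, -, -⟩, -⟩ := FrdI.thm34iii_ofFunctor_of_isOfFSMFFType2024 (isFrobenioid_istr hF₂)
    (isFrobenioid_istr hF₁) hD₂ hD₁ Ψi.symm hs₂' hs₁' hBi'
  exact cor412_of_istr hF₁ hF₂ Ψ Ψi core
    (exists_toBaseDeg_equivalence_of_isOfFSMFFType2024 (isFrobenioid_istr hF₁) hsq₁ (isFrobenioid_istr hF₂) hsq₂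
      Ψi hB₁ hB₂
      ((PreFrobenioidData.ofFunctor_isOfIsotropicType _).2 isOfIsotropicType_istr)
      ((PreFrobenioidData.ofFunctor_isOfIsotropicType _).2 isOfIsotropicType_istr)
      hD₁ hD₂ hstd₁ hstd₂ hfs₁ hfs₂ hΨ hΨ' hbi hbi')
    R₁ R₂ hfs₁ hfs₂ hR₁ hR₂ hB

end General

end FrdI

end Literature.AlgebraicGeometry.Frobenioids
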